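import Mathlib.RingTheory.PowerSeries.Derivative
import Mathlib.Data.Nat.Choose.Vandermonde
import Mathlib.Algebra.BigOperators.NatAntidiagonal
import Mathlib.Tactic
import HarnessLib

/-!
# The Domb numbers and their Apéry-like recurrence

The **Domb numbers** `D_k = Σ_{j ≤ k} C(k,j)² Σ_{i ≤ j} C(j,i)² C(2i,i) = 1, 4, 28, 256, 2716, …`
are the even moments `W₄(2k)` of the distance travelled by a planar uniform random walk in four
steps (`Literature.Analysis.FunctionSpaces.integral_norm_pow_four`, file
`Literature/Analysis/FunctionSpaces/UniformRandomWalkMoments.lean`, where they appear in exactly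
this nested form, `W₄(2k) = Σ_j C(k,j)² W₃(2j)`). Their generating series `y₀(z) = Σ D_k z^k` is
annihilated by the operator `B₄ = 64z²(θ+1)³ − 2z(2θ+1)(5θ²+5θ+2) + θ³`, `θ = z d/dz`
[BorweinEtAl2012, §4 Remark 6], i.e. the Domb numbers satisfy the three-term recurrence

  `(k+1)³ D_{k+1} − 2(2k+1)(5k²+5k+2) D_k + 64 k³ D_{k−1} = 0`    (`k ≥ 1`),

which is also the functional equation
`(s+4)³W₄(s+4) − 4(s+3)(5s²+30s+48)W₄(s+2) + 64(s+2)³W₄(s) = 0` of [BorweinEtAl2012, §2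
Example 1] at the even integers `s = 2k − 2`. This file PROVES the recurrence
(`Literature.Combinatorics.Enumerative.domb_recurrence`).

## Proof

Not by creative telescoping but by the exponential generating function: with
`U(X) = Σ_n X^n/(n!)²` (formally `I₀(2√X)`), the Cauchy product gives
`[X^n] U⁴ = D_n/(n!)²` (`coeff_U_pow_four`; the nested binomial form of `D_n` is literally
`U⁴ = ((U·U)·U)·U`), and `U` satisfies `θ²U = X·U`. For ANY derivation `θ` of a commutative ring
with `θ x = x`, `θ²u = x u`, the fourth power `h = u⁴` satisfies the fifth-order equation
(symmetric fourth power of `θ² − x`)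

  `θ⁵h = x·(20θ³h + 30θ²h + 18θh + 4h) − 64x²·(θh + h)`

(`symmetricFourthPower_identity`, a finite Leibniz computation), and comparing coefficients of
`X^{k+1}` gives `(k+1)⁵ D_{k+1}/((k+1)!)² = (20k³+30k²+18k+4) D_k/(k!)² − 64k·D_{k−1}/((k−1)!)²`,
which is the recurrence after multiplication by `(k!)²` (`2(2k+1)(5k²+5k+2) = 20k³+30k²+18k+4`).

## References

* [BorweinEtAl2012] J. M. Borwein, A. Straub, J. Wan, W. Zudilin, *Densities of short uniform
  random walks*, Canad. J. Math. 64 (2012) 961–990 (arXiv:1103.2995): §2 Example 1 (functional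
  equation of `W₄`), §4 Remark 6 (the Domb series `y₀` and the operator `B₄`).
* C. Domb, On the theory of cooperative phenomena in crystals, Adv. Phys. 9 (1960) 149–361.
-/

noncomputable section

open Finset PowerSeries
open scoped Nat

namespace Literature.Combinatorics.Enumerative

/-! ### The Domb numbers -/

/-- The even moments `W₃(2k) = Σ_{i ≤ k} C(k,i)² C(2i,i)` of the three-step walk
(`1, 3, 15, 93, 639, …`). [cite: BorweinEtAl2012, §1 eq. (1.1)] -/
def threeStepMoment (k : ℕ) : ℕ := ∑ i ∈ range (k + 1), k.choose i ^ 2 * (2 * i).choose i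

/-- The **Domb numbers** `D_k = W₄(2k) = Σ_{j ≤ k} C(k,j)² W₃(2j)` (`1, 4, 28, 256, 2716, …`), in
the nested form of `Literature.Analysis.FunctionSpaces.integral_norm_pow_four`.
[cite: BorweinEtAl2012, §4 Remark 6] -/
def domb (k : ℕ) : ℕ := ∑ j ∈ range (k + 1), k.choose j ^ 2 * threeStepMoment j

/-- `D₀ = 1`. [cite: BorweinEtAl2012, §4] -/
theorem domb_zero : domb 0 = 1 := by decide

/-- `D₁ = 4`. [cite: BorweinEtAl2012, §4] -/
theorem domb_one : domb 1 = 4 := by decide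

/-- `D₂ = 28`. [cite: BorweinEtAl2012, §4] -/
theorem domb_two : domb 2 = 28 := by decide

/-- `D₃ = 256`. [cite: BorweinEtAl2012, §4] -/
theorem domb_three : domb 3 = 256 := by decide

/-- `D₄ = 2716`. [cite: BorweinEtAl2012, §4] -/
theorem domb_four : domb 4 = 2716 := by decide

/-! ### The symmetric fourth power of `θ² − x` -/

/-- **Differential algebra.** For a derivation `θ` of a commutative algebra and elements `x, u`
with `θ x = x` and `θ(θ u) = x·u`, the fourth power `h = u⁴` satisfies
`θ⁵h = x(20θ³h + 30θ²h + 18θh + 4h) − 64x²(θh + h)` — the operator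
`θ⁵ − x(2θ+1)(10θ²+10θ+4) + 64x²(θ+1)`, whose coefficient recurrence is the Domb recurrence.
[folklore] -/
theorem symmetricFourthPower_identity {R A : Type*} [CommRing R] [CommRing A] [Algebra R A]
    (θ : Derivation R A A) (x u : A) (hx : θ x = x) (hu : θ (θ u) = x * u) :
    θ (θ (θ (θ (θ (u ^ 4))))) =
      x * (20 * θ (θ (θ (u ^ 4))) + 30 * θ (θ (u ^ 4)) + 18 * θ (u ^ 4) + 4 * u ^ 4) -
        64 * x ^ 2 * (θ (u ^ 4) + u ^ 4) := by
  set v := θ u with hv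
  -- derivatives of the monomials that occur
  have hx2 : θ (x ^ 2) = 2 • (x ^ 2) := by
    rw [θ.leibniz_pow, hx]; simp only [smul_eq_mul, nsmul_eq_mul]; ring
  have m1 : θ (u ^ 4) = 4 • (u ^ 3 * v) := by
    rw [θ.leibniz_pow]; simp only [smul_eq_mul, nsmul_eq_mul, ← hv]
  have m2 : θ (u ^ 3 * v) = 3 • (u ^ 2 * v ^ 2) + x * u ^ 4 := by
    rw [θ.leibniz, θ.leibniz_pow, hu]; simp only [smul_eq_mul, nsmul_eq_mul, ← hv]; ring
  have m3 : θ (u ^ 2 * v ^ 2) = 2 • (u * v ^ 3) + 2 • (x * u ^ 3 * v) := by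
    rw [θ.leibniz, θ.leibniz_pow, θ.leibniz_pow, hu]
    simp only [smul_eq_mul, nsmul_eq_mul, ← hv]; ring
  have m4 : θ (u * v ^ 3) = v ^ 4 + 3 • (x * u ^ 2 * v ^ 2) := by
    rw [θ.leibniz, θ.leibniz_pow, hu]; simp only [smul_eq_mul, nsmul_eq_mul, ← hv]; ring
  have m5 : θ (v ^ 4) = 4 • (x * u * v ^ 3) := by
    rw [θ.leibniz_pow, hu]; simp only [smul_eq_mul, nsmul_eq_mul]; ring
  have mx1 : θ (x * u ^ 4) = x * u ^ 4 + 4 • (x * u ^ 3 * v) := by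
    rw [θ.leibniz, m1, hx]; simp only [smul_eq_mul, nsmul_eq_mul]; ring
  have mx2 : θ (x * u ^ 3 * v) = x * u ^ 3 * v + 3 • (x * u ^ 2 * v ^ 2) + x ^ 2 * u ^ 4 := by
    rw [mul_assoc, θ.leibniz, m2, hx]; simp only [smul_eq_mul, nsmul_eq_mul]; ring
  have mx3 : θ (x * u ^ 2 * v ^ 2) =
      x * u ^ 2 * v ^ 2 + 2 • (x * u * v ^ 3) + 2 • (x ^ 2 * u ^ 3 * v) := by
    rw [mul_assoc, θ.leibniz, m3, hx]; simp only [smul_eq_mul, nsmul_eq_mul]; ring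
  have mx4 : θ (x * u * v ^ 3) = x * u * v ^ 3 + x * v ^ 4 + 3 • (x ^ 2 * u ^ 2 * v ^ 2) := by
    rw [mul_assoc, θ.leibniz, m4, hx]; simp only [smul_eq_mul, nsmul_eq_mul]; ring
  have mxx1 : θ (x ^ 2 * u ^ 4) = 2 • (x ^ 2 * u ^ 4) + 4 • (x ^ 2 * u ^ 3 * v) := by
    rw [θ.leibniz, m1, hx2]; simp only [smul_eq_mul, nsmul_eq_mul]; ring
  -- the iterated derivatives of h = u⁴
  have L1 : θ (u ^ 4) = 4 • (u ^ 3 * v) := m1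
  have L2 : θ (θ (u ^ 4)) = 12 • (u ^ 2 * v ^ 2) + 4 • (x * u ^ 4) := by
    rw [L1, map_nsmul, m2]; simp only [nsmul_eq_mul]; push_cast; ring
  have L3 : θ (θ (θ (u ^ 4))) = 24 • (u * v ^ 3) + 40 • (x * u ^ 3 * v) + 4 • (x * u ^ 4) := by
    rw [L2, map_add, map_nsmul, map_nsmul, m3, mx1]; simp only [nsmul_eq_mul]; push_cast; ring
  have L4 : θ (θ (θ (θ (u ^ 4)))) = 24 • (v ^ 4) + 192 • (x * u ^ 2 * v ^ 2) +
      56 • (x * u ^ 3 * v) + 4 • (x * u ^ 4) + 40 • (x ^ 2 * u ^ 4) := by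
    rw [L3, map_add, map_add, map_nsmul, map_nsmul, map_nsmul, m4, mx2, mx1]
    simp only [nsmul_eq_mul]; push_cast; ring
  have L5 : θ (θ (θ (θ (θ (u ^ 4))))) = 480 • (x * u * v ^ 3) + 360 • (x * u ^ 2 * v ^ 2) +
      72 • (x * u ^ 3 * v) + 4 • (x * u ^ 4) + 544 • (x ^ 2 * u ^ 3 * v) +
        136 • (x ^ 2 * u ^ 4) := by
    rw [L4, map_add, map_add, map_add, map_add, map_nsmul, map_nsmul, map_nsmul, map_nsmul,
      map_nsmul, m5, mx3, mx2, mx1, mxx1]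
    simp only [nsmul_eq_mul]; push_cast; ring
  rw [L5, L3, L2, L1]
  simp only [nsmul_eq_mul]; push_cast; ring

/-! ### The series `U = Σ Xⁿ/(n!)²` and the Euler operator `θ = X·d/dX` -/

/-- The Euler operator `θ = X · d/dX` on `ℚ⟦X⟧`, as a derivation. [folklore] -/
def eulerOp : Derivation ℚ ℚ⟦X⟧ ℚ⟦X⟧ := (X : ℚ⟦X⟧) • derivative ℚ

/-- `θ f = X · f′`. [folklore] -/
theorem eulerOp_apply (f : ℚ⟦X⟧) : eulerOp f = X * derivative ℚ f := rfl

/-- `[Xⁿ] θf = n · [Xⁿ] f`. [folklore] -/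
theorem coeff_eulerOp (f : ℚ⟦X⟧) (n : ℕ) : coeff n (eulerOp f) = n * coeff n f := by
  rw [eulerOp_apply]
  cases n with
  | zero => simp
  | succ m => rw [coeff_succ_X_mul, coeff_derivative]; push_cast; ring

/-- `θ X = X`. [folklore] -/
theorem eulerOp_X : eulerOp (X : ℚ⟦X⟧) = X := by
  rw [eulerOp_apply, derivative_X, mul_one]

/-- `U(X) = Σ_n Xⁿ/(n!)²` — formally `I₀(2√X)`; `Uⁿ` is the generating function of
`W_n(2k)/(k!)²`. [folklore] -/
def besselU : ℚ⟦X⟧ := PowerSeries.mk fun n => ((n ! : ℚ) ^ 2)⁻¹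

/-- `[Xⁿ] U = 1/(n!)²`. [folklore] -/
theorem coeff_besselU (n : ℕ) : coeff n besselU = ((n ! : ℚ) ^ 2)⁻¹ := coeff_mk _ _

/-- `θ²U = X·U` (the Bessel equation of `I₀(2√X)` in Euler form). [folklore] -/
theorem eulerOp_eulerOp_besselU : eulerOp (eulerOp besselU) = X * besselU := by
  ext n
  rw [coeff_eulerOp, coeff_eulerOp, coeff_besselU]
  cases n with
  | zero => simp
  | succ m =>
    rw [coeff_succ_X_mul, coeff_besselU, Nat.factorial_succ]
    push_cast
    have hm : (m ! : ℚ) ≠ 0 := by positivity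
    field_simp

/-! ### Coefficients of `U²`, `U³`, `U⁴` -/

/-- `1/((i!)²((n−i)!)²) = C(n,i)²/(n!)²` for `i ≤ n`. [folklore] -/
theorem inv_factorial_sq_mul_inv_factorial_sq {n i : ℕ} (hi : i ≤ n) :
    ((i ! : ℚ) ^ 2)⁻¹ * (((n - i) ! : ℚ) ^ 2)⁻¹ = (n.choose i : ℚ) ^ 2 / (n ! : ℚ) ^ 2 := by
  have h : (n.choose i : ℚ) * i ! * (n - i)! = n ! := by
    exact_mod_cast Nat.choose_mul_factorial_mul_factorial hi
  have hi0 : (i ! : ℚ) ≠ 0 := by positivity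
  have hni0 : ((n - i) ! : ℚ) ≠ 0 := by positivity
  have hc0 : (n.choose i : ℚ) ≠ 0 := by exact_mod_cast (Nat.choose_pos hi).ne'
  rw [← h]
  field_simp

/-- `[Xⁿ] U² = C(2n,n)/(n!)²` (`W₂(2n) = C(2n,n)`, Vandermonde). [folklore] -/
theorem coeff_besselU_pow_two (n : ℕ) :
    coeff n (besselU ^ 2) = ((2 * n).choose n : ℚ) / (n ! : ℚ) ^ 2 := by
  rw [sq, coeff_mul, Nat.sum_antidiagonal_eq_sum_range_succ_mk]
  simp only [coeff_besselU]
  rw [← Nat.sum_range_choose_sq n, Nat.cast_sum, Finset.sum_div]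
  refine Finset.sum_congr rfl fun i hi => ?_
  rw [inv_factorial_sq_mul_inv_factorial_sq (Nat.lt_succ_iff.mp (mem_range.mp hi))]
  push_cast
  ring

/-- `[Xⁿ] U³ = W₃(2n)/(n!)²`. [folklore] -/
theorem coeff_besselU_pow_three (n : ℕ) :
    coeff n (besselU ^ 3) = (threeStepMoment n : ℚ) / (n ! : ℚ) ^ 2 := by
  rw [pow_succ, coeff_mul, Nat.sum_antidiagonal_eq_sum_range_succ_mk]
  simp only [coeff_besselU_pow_two, coeff_besselU]
  rw [threeStepMoment, Nat.cast_sum, Finset.sum_div]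
  refine Finset.sum_congr rfl fun i hi => ?_
  have key := inv_factorial_sq_mul_inv_factorial_sq (Nat.lt_succ_iff.mp (mem_range.mp hi))
  have hi0 : (i ! : ℚ) ≠ 0 := by positivity
  push_cast
  calc ((2 * i).choose i : ℚ) / (i ! : ℚ) ^ 2 * (((n - i) ! : ℚ) ^ 2)⁻¹
      = ((2 * i).choose i : ℚ) * (((i ! : ℚ) ^ 2)⁻¹ * (((n - i) ! : ℚ) ^ 2)⁻¹) := by ring
    _ = (n.choose i : ℚ) ^ 2 * ((2 * i).choose i : ℚ) / (n ! : ℚ) ^ 2 := by rw [key]; ring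

/-- **`[Xⁿ] U⁴ = D_n/(n!)²`**: the exponential generating function of the Domb numbers is
`U⁴ = I₀(2√X)⁴`. [folklore] -/
theorem coeff_besselU_pow_four (n : ℕ) :
    coeff n (besselU ^ 4) = (domb n : ℚ) / (n ! : ℚ) ^ 2 := by
  rw [pow_succ, coeff_mul, Nat.sum_antidiagonal_eq_sum_range_succ_mk]
  simp only [coeff_besselU_pow_three, coeff_besselU]
  rw [domb, Nat.cast_sum, Finset.sum_div]
  refine Finset.sum_congr rfl fun i hi => ?_
  have key := inv_factorial_sq_mul_inv_factorial_sq (Nat.lt_succ_iff.mp (mem_range.mp hi))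
  have hi0 : (i ! : ℚ) ≠ 0 := by positivity
  push_cast
  calc (threeStepMoment i : ℚ) / (i ! : ℚ) ^ 2 * (((n - i) ! : ℚ) ^ 2)⁻¹
      = (threeStepMoment i : ℚ) * (((i ! : ℚ) ^ 2)⁻¹ * (((n - i) ! : ℚ) ^ 2)⁻¹) := by ring
    _ = (n.choose i : ℚ) ^ 2 * (threeStepMoment i : ℚ) / (n ! : ℚ) ^ 2 := by rw [key]; ring

/-! ### The recurrence -/

/-- Coefficients of a numeral multiple. [folklore] -/
theorem coeff_ofNat_mul (m : ℕ) [m.AtLeastTwo] (f : ℚ⟦X⟧) (n : ℕ) :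
    coeff n ((ofNat(m) : ℚ⟦X⟧) * f) = (ofNat(m) : ℚ) * coeff n f := by
  rw [← map_ofNat (C (R := ℚ)) m, coeff_C_mul]

/-- The Domb recurrence in rational (exponential-generating-function) form: for all `j`,
`(j+2)⁵ D_{j+2}/((j+2)!)² = (20(j+1)³+30(j+1)²+18(j+1)+4) D_{j+1}/((j+1)!)² − 64(j+1) D_j/(j!)²`
— the coefficient of `X^{j+2}` in `symmetricFourthPower_identity` for `U`. [folklore] -/
theorem domb_recurrence_egf (j : ℕ) :
    ((j : ℚ) + 1 + 1) ^ 5 * ((domb (j + 1 + 1) : ℚ) / ((j + 1 + 1) ! : ℚ) ^ 2) =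
      (20 * ((j : ℚ) + 1) ^ 3 + 30 * ((j : ℚ) + 1) ^ 2 + 18 * ((j : ℚ) + 1) + 4) *
          ((domb (j + 1) : ℚ) / ((j + 1) ! : ℚ) ^ 2) -
        64 * (((j : ℚ) + 1) * ((domb j : ℚ) / (j ! : ℚ) ^ 2)) := by
  have hid := symmetricFourthPower_identity eulerOp (X : ℚ⟦X⟧) besselU eulerOp_X
    eulerOp_eulerOp_besselU
  rw [show (64 : ℚ⟦X⟧) * X ^ 2 * (eulerOp (besselU ^ 4) + besselU ^ 4) =
      64 * (X * (X * (eulerOp (besselU ^ 4) + besselU ^ 4))) by ring] at hid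
  have hc := congrArg (coeff (j + 1 + 1)) hid
  simp only [map_sub, map_add, coeff_eulerOp, coeff_succ_X_mul, coeff_ofNat_mul,
    coeff_besselU_pow_four] at hc
  push_cast at hc
  linear_combination hc

/-- **The Apéry-like recurrence of the Domb numbers** `D_k = W₄(2k)`:
`(k+1)³ D_{k+1} − 2(2k+1)(5k²+5k+2) D_k + 64k³ D_{k−1} = 0` for `k ≥ 1` — equivalently
`B₄ · y₀ = 0` for `y₀ = Σ D_k z^k`, `B₄ = 64z²(θ+1)³ − 2z(2θ+1)(5θ²+5θ+2) + θ³`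
[BorweinEtAl2012, §4 Remark 6], or the functional equation
`(s+4)³W₄(s+4) − 4(s+3)(5s²+30s+48)W₄(s+2) + 64(s+2)³W₄(s) = 0` of [BorweinEtAl2012, §2
Example 1] at `s = 2k − 2`. Stated in `ℕ` with the negative term moved across.
[cite: BorweinEtAl2012, §4 Remark 6 (operator B₄); §2 Example 1] -/
theorem domb_recurrence {k : ℕ} (hk : 1 ≤ k) :
    (k + 1) ^ 3 * domb (k + 1) + 64 * k ^ 3 * domb (k - 1) =
      2 * (2 * k + 1) * (5 * k ^ 2 + 5 * k + 2) * domb k := by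
  obtain ⟨j, rfl⟩ : ∃ j, k = j + 1 := ⟨k - 1, by omega⟩
  rw [Nat.add_sub_cancel]
  have h := domb_recurrence_egf j
  have hf1 : ((j + 1 + 1) ! : ℚ) = ((j : ℚ) + 1 + 1) * (((j : ℚ) + 1) * (j ! : ℚ)) := by
    rw [Nat.factorial_succ, Nat.factorial_succ]; push_cast; ring
  have hf2 : ((j + 1) ! : ℚ) = ((j : ℚ) + 1) * (j ! : ℚ) := by
    rw [Nat.factorial_succ]; push_cast; ring
  rw [hf1, hf2] at h
  have hj0 : (j ! : ℚ) ≠ 0 := by positivity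
  have hj1 : (j : ℚ) + 1 ≠ 0 := by positivity
  have hj2 : (j : ℚ) + 1 + 1 ≠ 0 := by positivity
  -- clear the denominators by hand (multiplier `M = ((j+1) j!)²`)
  have e1 : ((j : ℚ) + 1 + 1) ^ 5 *
      ((domb (j + 1 + 1) : ℚ) / (((j : ℚ) + 1 + 1) * (((j : ℚ) + 1) * (j ! : ℚ))) ^ 2) *
        ((((j : ℚ) + 1) * (j ! : ℚ)) ^ 2) = ((j : ℚ) + 1 + 1) ^ 3 * (domb (j + 1 + 1) : ℚ) := by
    field_simp
  have e2 : (20 * ((j : ℚ) + 1) ^ 3 + 30 * ((j : ℚ) + 1) ^ 2 + 18 * ((j : ℚ) + 1) + 4) *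
      ((domb (j + 1) : ℚ) / (((j : ℚ) + 1) * (j ! : ℚ)) ^ 2) * ((((j : ℚ) + 1) * (j ! : ℚ)) ^ 2) =
        (20 * ((j : ℚ) + 1) ^ 3 + 30 * ((j : ℚ) + 1) ^ 2 + 18 * ((j : ℚ) + 1) + 4) *
          (domb (j + 1) : ℚ) := by
    field_simp
  have e3 : 64 * (((j : ℚ) + 1) * ((domb j : ℚ) / (j ! : ℚ) ^ 2)) *
      ((((j : ℚ) + 1) * (j ! : ℚ)) ^ 2) = 64 * ((j : ℚ) + 1) ^ 3 * (domb j : ℚ) := by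
    field_simp
  have key : ((j : ℚ) + 1 + 1) ^ 3 * (domb (j + 1 + 1) : ℚ) + 64 * ((j : ℚ) + 1) ^ 3 * (domb j : ℚ)
      = 2 * (2 * ((j : ℚ) + 1) + 1) * (5 * ((j : ℚ) + 1) ^ 2 + 5 * ((j : ℚ) + 1) + 2) *
          (domb (j + 1) : ℚ) := by
    linear_combination ((((j : ℚ) + 1) * (j ! : ℚ)) ^ 2) * h - e1 + e2 - e3
  exact_mod_cast key

/-- The recurrence at `k = 0`: `D₁ = 4 D₀`. [folklore] -/
theorem domb_recurrence_zero : domb 1 = 4 * domb 0 := by decide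

/-! ### Domb's symmetric form -/

/-- `[Xⁿ] U⁴ = [Xⁿ] (U²)² = Σ_j C(n,j)² C(2j,j) C(2n−2j,n−j) / (n!)²`. [folklore] -/
theorem coeff_besselU_pow_four_symm (n : ℕ) :
    coeff n (besselU ^ 4) =
      (∑ j ∈ range (n + 1),
          ((n.choose j : ℚ) ^ 2 * (2 * j).choose j * (2 * (n - j)).choose (n - j))) /
        (n ! : ℚ) ^ 2 := by
  rw [show besselU ^ 4 = besselU ^ 2 * besselU ^ 2 by ring, coeff_mul,
    Nat.sum_antidiagonal_eq_sum_range_succ_mk]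
  simp only [coeff_besselU_pow_two]
  rw [Finset.sum_div]
  refine Finset.sum_congr rfl fun i hi => ?_
  have key := inv_factorial_sq_mul_inv_factorial_sq (Nat.lt_succ_iff.mp (mem_range.mp hi))
  have hi0 : (i ! : ℚ) ≠ 0 := by positivity
  have hni0 : ((n - i) ! : ℚ) ≠ 0 := by positivity
  calc ((2 * i).choose i : ℚ) / (i ! : ℚ) ^ 2 *
        (((2 * (n - i)).choose (n - i) : ℚ) / ((n - i) ! : ℚ) ^ 2)
      = ((2 * i).choose i : ℚ) * ((2 * (n - i)).choose (n - i) : ℚ) *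
          (((i ! : ℚ) ^ 2)⁻¹ * (((n - i) ! : ℚ) ^ 2)⁻¹) := by ring
    _ = (n.choose i : ℚ) ^ 2 * ((2 * i).choose i : ℚ) * ((2 * (n - i)).choose (n - i) : ℚ) /
          (n ! : ℚ) ^ 2 := by rw [key]; ring

/-- **Domb's symmetric form** `D_k = Σ_j C(k,j)² C(2j,j) C(2k−2j,k−j)` (Domb 1960; the usual
definition of OEIS A002895), equal to the nested random-walk form `Σ_j C(k,j)² W₃(2j)` because both
are `(k!)² [X^k] I₀(2√X)⁴`. [folklore] -/
theorem domb_eq_sum_choose_sq_mul_centralBinom (k : ℕ) :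
    domb k =
      ∑ j ∈ range (k + 1), k.choose j ^ 2 * (2 * j).choose j * (2 * (k - j)).choose (k - j) := by
  have h2 := coeff_besselU_pow_four_symm k
  rw [coeff_besselU_pow_four] at h2
  have hk : ((k ! : ℚ)) ^ 2 ≠ 0 := by positivity
  have h3 := (div_left_inj' hk).mp h2
  exact_mod_cast h3

/-! ### The three-step moments `W₃(2k)`: the Apéry-like recurrence of `Σ_i C(k,i)² C(2i,i)` -/

/-- **Differential algebra, symmetric cube.** For a derivation `θ` with `θ x = x`, `θ(θ u) = x u`,
the cube `h = u³` satisfies `θ⁴h = x(10θ²h + 10θh + 3h) − 9x²h` — the symmetric cube of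
`θ² − x`, whose coefficient recurrence is that of `W₃(2k)`. [folklore] -/
theorem symmetricCube_identity {R A : Type*} [CommRing R] [CommRing A] [Algebra R A]
    (θ : Derivation R A A) (x u : A) (hx : θ x = x) (hu : θ (θ u) = x * u) :
    θ (θ (θ (θ (u ^ 3)))) =
      x * (10 * θ (θ (u ^ 3)) + 10 * θ (u ^ 3) + 3 * u ^ 3) - 9 * x ^ 2 * u ^ 3 := by
  set v := θ u with hv
  have m1 : θ (u ^ 3) = 3 • (u ^ 2 * v) := by
    rw [θ.leibniz_pow]; simp only [smul_eq_mul, nsmul_eq_mul, ← hv]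
  have m2 : θ (u ^ 2 * v) = 2 • (u * v ^ 2) + x * u ^ 3 := by
    rw [θ.leibniz, θ.leibniz_pow, hu]; simp only [smul_eq_mul, nsmul_eq_mul, ← hv]; ring
  have m3 : θ (u * v ^ 2) = v ^ 3 + 2 • (x * u ^ 2 * v) := by
    rw [θ.leibniz, θ.leibniz_pow, hu]; simp only [smul_eq_mul, nsmul_eq_mul, ← hv]; ring
  have m4 : θ (v ^ 3) = 3 • (x * u * v ^ 2) := by
    rw [θ.leibniz_pow, hu]; simp only [smul_eq_mul, nsmul_eq_mul]; ring
  have mx1 : θ (x * u ^ 3) = x * u ^ 3 + 3 • (x * u ^ 2 * v) := by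
    rw [θ.leibniz, m1, hx]; simp only [smul_eq_mul, nsmul_eq_mul]; ring
  have mx2 : θ (x * u ^ 2 * v) = x * u ^ 2 * v + 2 • (x * u * v ^ 2) + x ^ 2 * u ^ 3 := by
    rw [mul_assoc, θ.leibniz, m2, hx]; simp only [smul_eq_mul, nsmul_eq_mul]; ring
  have L1 : θ (u ^ 3) = 3 • (u ^ 2 * v) := m1
  have L2 : θ (θ (u ^ 3)) = 6 • (u * v ^ 2) + 3 • (x * u ^ 3) := by
    rw [L1, map_nsmul, m2]; simp only [nsmul_eq_mul]; push_cast; ring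
  have L3 : θ (θ (θ (u ^ 3))) = 6 • (v ^ 3) + 21 • (x * u ^ 2 * v) + 3 • (x * u ^ 3) := by
    rw [L2, map_add, map_nsmul, map_nsmul, m3, mx1]; simp only [nsmul_eq_mul]; push_cast; ring
  have L4 : θ (θ (θ (θ (u ^ 3)))) = 60 • (x * u * v ^ 2) + 30 • (x * u ^ 2 * v) +
      21 • (x ^ 2 * u ^ 3) + 3 • (x * u ^ 3) := by
    rw [L3, map_add, map_add, map_nsmul, map_nsmul, map_nsmul, m4, mx2, mx1]
    simp only [nsmul_eq_mul]; push_cast; ring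
  rw [L4, L2, L1]
  simp only [nsmul_eq_mul]; push_cast; ring

/-- The `W₃(2k)` recurrence in rational form: for all `j`,
`(j+1)⁴ a_{j+1}/((j+1)!)² = (10j²+10j+3) a_j/(j!)² − 9·[j ≥ 1]·a_{j−1}/((j−1)!)²`, read off from
`symmetricCube_identity` for `U`; here for the shifted index `j + 1`. [folklore] -/
theorem threeStepMoment_recurrence_egf (j : ℕ) :
    ((j : ℚ) + 1 + 1) ^ 4 * ((threeStepMoment (j + 1 + 1) : ℚ) / ((j + 1 + 1) ! : ℚ) ^ 2) =
      (10 * ((j : ℚ) + 1) ^ 2 + 10 * ((j : ℚ) + 1) + 3) *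
          ((threeStepMoment (j + 1) : ℚ) / ((j + 1) ! : ℚ) ^ 2) -
        9 * ((threeStepMoment j : ℚ) / (j ! : ℚ) ^ 2) := by
  have hid := symmetricCube_identity eulerOp (X : ℚ⟦X⟧) besselU eulerOp_X eulerOp_eulerOp_besselU
  rw [show (9 : ℚ⟦X⟧) * X ^ 2 * besselU ^ 3 = 9 * (X * (X * besselU ^ 3)) by ring] at hid
  have hc := congrArg (coeff (j + 1 + 1)) hid
  simp only [map_sub, map_add, coeff_eulerOp, coeff_succ_X_mul, coeff_ofNat_mul,
    coeff_besselU_pow_three] at hc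
  push_cast at hc
  linear_combination hc

/-- **The Apéry-like recurrence of the three-step moments** `a_k = W₃(2k) = Σ_i C(k,i)² C(2i,i)`
(`1, 3, 15, 93, 639, …`): `(k+1)² a_{k+1} − (10k²+10k+3) a_k + 9k² a_{k−1} = 0` for `k ≥ 1` —
the functional equation `(s+4)²W₃(s+4) − 2(5s²+30s+46)W₃(s+2) + 9(s+2)²W₃(s) = 0` of
[BorweinEtAl2012, §2] at `s = 2k − 2` (divided by `4`). Stated in `ℕ`.
[cite: BorweinEtAl2012, §2 (functional equation of W₃)] -/
theorem threeStepMoment_recurrence {k : ℕ} (hk : 1 ≤ k) :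
    (k + 1) ^ 2 * threeStepMoment (k + 1) + 9 * k ^ 2 * threeStepMoment (k - 1) =
      (10 * k ^ 2 + 10 * k + 3) * threeStepMoment k := by
  obtain ⟨j, rfl⟩ : ∃ j, k = j + 1 := ⟨k - 1, by omega⟩
  rw [Nat.add_sub_cancel]
  have h := threeStepMoment_recurrence_egf j
  have hf1 : ((j + 1 + 1) ! : ℚ) = ((j : ℚ) + 1 + 1) * (((j : ℚ) + 1) * (j ! : ℚ)) := by
    rw [Nat.factorial_succ, Nat.factorial_succ]; push_cast; ring
  have hf2 : ((j + 1) ! : ℚ) = ((j : ℚ) + 1) * (j ! : ℚ) := by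
    rw [Nat.factorial_succ]; push_cast; ring
  rw [hf1, hf2] at h
  have hj0 : (j ! : ℚ) ≠ 0 := by positivity
  have hj1 : (j : ℚ) + 1 ≠ 0 := by positivity
  have hj2 : (j : ℚ) + 1 + 1 ≠ 0 := by positivity
  have e1 : ((j : ℚ) + 1 + 1) ^ 4 *
      ((threeStepMoment (j + 1 + 1) : ℚ) / (((j : ℚ) + 1 + 1) * (((j : ℚ) + 1) * (j ! : ℚ))) ^ 2) *
        ((((j : ℚ) + 1) * (j ! : ℚ)) ^ 2) =
      ((j : ℚ) + 1 + 1) ^ 2 * (threeStepMoment (j + 1 + 1) : ℚ) := by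
    field_simp
  have e2 : (10 * ((j : ℚ) + 1) ^ 2 + 10 * ((j : ℚ) + 1) + 3) *
      ((threeStepMoment (j + 1) : ℚ) / (((j : ℚ) + 1) * (j ! : ℚ)) ^ 2) *
        ((((j : ℚ) + 1) * (j ! : ℚ)) ^ 2) =
      (10 * ((j : ℚ) + 1) ^ 2 + 10 * ((j : ℚ) + 1) + 3) * (threeStepMoment (j + 1) : ℚ) := by
    field_simp
  have e3 : 9 * ((threeStepMoment j : ℚ) / (j ! : ℚ) ^ 2) * ((((j : ℚ) + 1) * (j ! : ℚ)) ^ 2) =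
      9 * ((j : ℚ) + 1) ^ 2 * (threeStepMoment j : ℚ) := by
    field_simp
  have key : ((j : ℚ) + 1 + 1) ^ 2 * (threeStepMoment (j + 1 + 1) : ℚ) +
      9 * ((j : ℚ) + 1) ^ 2 * (threeStepMoment j : ℚ) =
      (10 * ((j : ℚ) + 1) ^ 2 + 10 * ((j : ℚ) + 1) + 3) * (threeStepMoment (j + 1) : ℚ) := by
    linear_combination ((((j : ℚ) + 1) * (j ! : ℚ)) ^ 2) * h - e1 + e2 - e3
  exact_mod_cast key

/-- The first three-step moments: `a₀ = 1`, `a₁ = 3`, `a₂ = 15`, `a₃ = 93`.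
[cite: BorweinEtAl2012, §1 eq. (1.1)] -/
theorem threeStepMoment_values :
    threeStepMoment 0 = 1 ∧ threeStepMoment 1 = 3 ∧ threeStepMoment 2 = 15 ∧
      threeStepMoment 3 = 93 := by
  decide

/-! ### The five-step moments `W₅(2k) = Σ_j C(k,j)² D_j` and their recurrence -/

/-- The even moments `W₅(2k) = Σ_{j ≤ k} C(k,j)² W₄(2j)` of the five-step walk
(`1, 5, 45, 545, 7885, …`), nested as in `Literature.Analysis.FunctionSpaces.integral_norm_pow_succ`.
[cite: BorweinEtAl2012, §1 eq. (1.1)] -/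
def fiveStepMoment (k : ℕ) : ℕ := ∑ j ∈ range (k + 1), k.choose j ^ 2 * domb j

/-- `W₅(0), …, W₅(8) = 1, 5, 45, 545, 7885`. [cite: BorweinEtAl2012, §1 eq. (1.1)] -/
theorem fiveStepMoment_values :
    fiveStepMoment 0 = 1 ∧ fiveStepMoment 1 = 5 ∧ fiveStepMoment 2 = 45 ∧
      fiveStepMoment 3 = 545 ∧ fiveStepMoment 4 = 7885 := by
  decide

/-- `[Xⁿ] U⁵ = W₅(2n)/(n!)²`. [folklore] -/
theorem coeff_besselU_pow_five (n : ℕ) :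
    coeff n (besselU ^ 5) = (fiveStepMoment n : ℚ) / (n ! : ℚ) ^ 2 := by
  rw [pow_succ, coeff_mul, Nat.sum_antidiagonal_eq_sum_range_succ_mk]
  simp only [coeff_besselU_pow_four, coeff_besselU]
  rw [fiveStepMoment, Nat.cast_sum, Finset.sum_div]
  refine Finset.sum_congr rfl fun i hi => ?_
  have key := inv_factorial_sq_mul_inv_factorial_sq (Nat.lt_succ_iff.mp (mem_range.mp hi))
  have hi0 : (i ! : ℚ) ≠ 0 := by positivity
  push_cast
  calc (domb i : ℚ) / (i ! : ℚ) ^ 2 * (((n - i) ! : ℚ) ^ 2)⁻¹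
      = (domb i : ℚ) * (((i ! : ℚ) ^ 2)⁻¹ * (((n - i) ! : ℚ) ^ 2)⁻¹) := by ring
    _ = (n.choose i : ℚ) ^ 2 * (domb i : ℚ) / (n ! : ℚ) ^ 2 := by rw [key]; ring

/-- **Differential algebra, symmetric fifth power.** For a derivation `θ` with `θ x = x`,
`θ(θ u) = x u`, the fifth power `h = u⁵` satisfies
`θ⁶h = x(35θ⁴+70θ³+63θ²+28θ+5)h − x²(259θ²+518θ+285)h + 225x³h` — the symmetric fifth power of
`θ² − x`, whose coefficient recurrence is that of `W₅(2k)`. [folklore] -/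
theorem symmetricFifthPower_identity {R A : Type*} [CommRing R] [CommRing A] [Algebra R A]
    (θ : Derivation R A A) (x u : A) (hx : θ x = x) (hu : θ (θ u) = x * u) :
    θ (θ (θ (θ (θ (θ (u ^ 5)))))) =
      x * (35 * θ (θ (θ (θ (u ^ 5)))) + 70 * θ (θ (θ (u ^ 5))) + 63 * θ (θ (u ^ 5)) +
          28 * θ (u ^ 5) + 5 * u ^ 5) -
        x ^ 2 * (259 * θ (θ (u ^ 5)) + 518 * θ (u ^ 5) + 285 * u ^ 5) + 225 * x ^ 3 * u ^ 5 := by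
  set v := θ u with hv
  -- θ on monomials `x^a u^b v^c`
  have hxpow : ∀ a : ℕ, θ (x ^ a) = a • x ^ a := by
    intro a
    rw [θ.leibniz_pow, hx]
    rcases a with _ | a
    · simp
    · simp only [Nat.add_sub_cancel, smul_eq_mul, nsmul_eq_mul]; ring
  have hupow : ∀ b : ℕ, θ (u ^ b) = b • (u ^ (b - 1) * v) := by
    intro b; rw [θ.leibniz_pow, ← hv]; simp only [smul_eq_mul, nsmul_eq_mul]
  have hvpow : ∀ c : ℕ, θ (v ^ c) = c • (x * u * v ^ (c - 1)) := by
    intro c; rw [θ.leibniz_pow, hu]; simp only [smul_eq_mul, nsmul_eq_mul]; ring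
  have mono : ∀ a b c : ℕ, θ (x ^ a * u ^ b * v ^ c) =
      a • (x ^ a * u ^ b * v ^ c) + b • (x ^ a * u ^ (b - 1) * v ^ (c + 1)) +
        c • (x ^ (a + 1) * u ^ (b + 1) * v ^ (c - 1)) := by
    intro a b c
    rw [θ.leibniz, θ.leibniz, hxpow, hupow, hvpow]
    simp only [smul_eq_mul, nsmul_eq_mul]
    ring
  have L1 : θ (x ^ 0 * u ^ 5 * v ^ 0) =
      5 • (x ^ 0 * u ^ 4 * v ^ 1) := by
    rw [mono]; simp only [nsmul_eq_mul]; push_cast; ring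
  have L2 : θ (θ (x ^ 0 * u ^ 5 * v ^ 0)) =
      20 • (x ^ 0 * u ^ 3 * v ^ 2) + 5 • (x ^ 1 * u ^ 5 * v ^ 0) := by
    rw [L1]
    simp only [map_nsmul, mono]
    simp only [nsmul_eq_mul]; push_cast; ring
  have L3 : θ (θ (θ (x ^ 0 * u ^ 5 * v ^ 0))) =
      60 • (x ^ 0 * u ^ 2 * v ^ 3) + 65 • (x ^ 1 * u ^ 4 * v ^ 1) + 5 • (x ^ 1 * u ^ 5 * v ^ 0) := by
    rw [L2]
    simp only [map_add, map_nsmul, mono]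
    simp only [nsmul_eq_mul]; push_cast; ring
  have L4 : θ (θ (θ (θ (x ^ 0 * u ^ 5 * v ^ 0)))) =
      120 • (x ^ 0 * u ^ 1 * v ^ 4) + 440 • (x ^ 1 * u ^ 3 * v ^ 2) + 90 • (x ^ 1 * u ^ 4 * v ^ 1) + 5 • (x ^ 1 * u ^ 5 * v ^ 0) + 65 • (x ^ 2 * u ^ 5 * v ^ 0) := by
    rw [L3]
    simp only [map_add, map_nsmul, mono]
    simp only [nsmul_eq_mul]; push_cast; ring
  have L5 : θ (θ (θ (θ (θ (x ^ 0 * u ^ 5 * v ^ 0))))) =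
      120 • (x ^ 0 * u ^ 0 * v ^ 5) + 1800 • (x ^ 1 * u ^ 2 * v ^ 3) + 800 • (x ^ 1 * u ^ 3 * v ^ 2) + 115 • (x ^ 1 * u ^ 4 * v ^ 1) + 5 • (x ^ 1 * u ^ 5 * v ^ 0) + 1205 • (x ^ 2 * u ^ 4 * v ^ 1) + 220 • (x ^ 2 * u ^ 5 * v ^ 0) := by
    rw [L4]
    simp only [map_add, map_nsmul, mono]
    simp only [nsmul_eq_mul]; push_cast; ring
  have L6 : θ (θ (θ (θ (θ (θ (x ^ 0 * u ^ 5 * v ^ 0)))))) =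
      4200 • (x ^ 1 * u ^ 1 * v ^ 4) + 4200 • (x ^ 1 * u ^ 2 * v ^ 3) + 1260 • (x ^ 1 * u ^ 3 * v ^ 2) + 140 • (x ^ 1 * u ^ 4 * v ^ 1) + 5 • (x ^ 1 * u ^ 5 * v ^ 0) + 10220 • (x ^ 2 * u ^ 3 * v ^ 2) + 5110 • (x ^ 2 * u ^ 4 * v ^ 1) + 555 • (x ^ 2 * u ^ 5 * v ^ 0) + 1205 • (x ^ 3 * u ^ 5 * v ^ 0) := by
    rw [L5]
    simp only [map_add, map_nsmul, mono]
    simp only [nsmul_eq_mul]; push_cast; ring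
  have hh : u ^ 5 = x ^ 0 * u ^ 5 * v ^ 0 := by ring
  rw [hh, L6, L4, L3, L2, L1]
  simp only [nsmul_eq_mul]; push_cast; ring

/-- The `W₅(2k)` recurrence in rational form (coefficient of `X^{j+3}` in
`symmetricFifthPower_identity` for `U`): `(j+3)⁶ h_{j+3} = P(j+2) h_{j+2} − Q(j+1) h_{j+1} + 225 h_j`
with `h_m = W₅(2m)/(m!)²`, `P(m) = 35m⁴+70m³+63m²+28m+5`, `Q(m) = 259m²+518m+285`. [folklore] -/
theorem fiveStepMoment_recurrence_egf (j : ℕ) :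
    ((j : ℚ) + 1 + 1 + 1) ^ 6 * ((fiveStepMoment (j + 1 + 1 + 1) : ℚ) / ((j + 1 + 1 + 1) ! : ℚ) ^ 2) =
      (35 * ((j : ℚ) + 1 + 1) ^ 4 + 70 * ((j : ℚ) + 1 + 1) ^ 3 + 63 * ((j : ℚ) + 1 + 1) ^ 2 +
            28 * ((j : ℚ) + 1 + 1) + 5) *
          ((fiveStepMoment (j + 1 + 1) : ℚ) / ((j + 1 + 1) ! : ℚ) ^ 2) -
        (259 * ((j : ℚ) + 1) ^ 2 + 518 * ((j : ℚ) + 1) + 285) *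
          ((fiveStepMoment (j + 1) : ℚ) / ((j + 1) ! : ℚ) ^ 2) +
        225 * ((fiveStepMoment j : ℚ) / (j ! : ℚ) ^ 2) := by
  have hid := symmetricFifthPower_identity eulerOp (X : ℚ⟦X⟧) besselU eulerOp_X
    eulerOp_eulerOp_besselU
  rw [show (X : ℚ⟦X⟧) ^ 2 * (259 * eulerOp (eulerOp (besselU ^ 5)) + 518 * eulerOp (besselU ^ 5) +
        285 * besselU ^ 5) =
      X * (X * (259 * eulerOp (eulerOp (besselU ^ 5)) + 518 * eulerOp (besselU ^ 5) +
        285 * besselU ^ 5)) by ring,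
    show (225 : ℚ⟦X⟧) * X ^ 3 * besselU ^ 5 = 225 * (X * (X * (X * besselU ^ 5))) by ring] at hid
  have hc := congrArg (coeff (j + 1 + 1 + 1)) hid
  simp only [map_sub, map_add, coeff_eulerOp, coeff_succ_X_mul, coeff_ofNat_mul,
    coeff_besselU_pow_five] at hc
  push_cast at hc
  linear_combination hc

/-- **The recurrence of the five-step moments** `a_k = W₅(2k)`: for `k ≥ 3`,
`k⁴ a_k − (35m⁴+70m³+63m²+28m+5)|_{m=k−1} a_{k−1} + (k−1)²(259(k−1)²+26) a_{k−2}
 − 225 (k−1)²(k−2)² a_{k−3} = 0` — the functional equation of `W₅` (Mellin translate of the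
operator `A₅` of [BorweinEtAl2012, Thm. 10]) at `s = 2k − 6`, divided by `16`. Stated in `ℕ`
with the index shifted (`k = j + 3`) and the negative terms moved across.
[cite: BorweinEtAl2012, §5 Thm. 10 (operator A₅) with §2 (moment recursions)] -/
theorem fiveStepMoment_recurrence (j : ℕ) :
    (j + 3) ^ 4 * fiveStepMoment (j + 3) +
        (j + 2) ^ 2 * (259 * (j + 2) ^ 2 + 26) * fiveStepMoment (j + 1) =
      (35 * (j + 2) ^ 4 + 70 * (j + 2) ^ 3 + 63 * (j + 2) ^ 2 + 28 * (j + 2) + 5) *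
          fiveStepMoment (j + 2) +
        225 * ((j + 1) * (j + 2)) ^ 2 * fiveStepMoment j := by
  have h := fiveStepMoment_recurrence_egf j
  have hf3 : ((j + 1 + 1 + 1) ! : ℚ) =
      ((j : ℚ) + 1 + 1 + 1) * (((j : ℚ) + 1 + 1) * (((j : ℚ) + 1) * (j ! : ℚ))) := by
    rw [Nat.factorial_succ, Nat.factorial_succ, Nat.factorial_succ]; push_cast; ring
  have hf2 : ((j + 1 + 1) ! : ℚ) = ((j : ℚ) + 1 + 1) * (((j : ℚ) + 1) * (j ! : ℚ)) := by
    rw [Nat.factorial_succ, Nat.factorial_succ]; push_cast; ring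
  have hf1 : ((j + 1) ! : ℚ) = ((j : ℚ) + 1) * (j ! : ℚ) := by
    rw [Nat.factorial_succ]; push_cast; ring
  rw [hf3, hf2, hf1] at h
  have hj0 : (j ! : ℚ) ≠ 0 := by positivity
  have hj1 : (j : ℚ) + 1 ≠ 0 := by positivity
  have hj2 : (j : ℚ) + 1 + 1 ≠ 0 := by positivity
  have hj3 : (j : ℚ) + 1 + 1 + 1 ≠ 0 := by positivity
  -- clear denominators with `M = ((j+2)(j+1) j!)²`
  have e1 : ((j : ℚ) + 1 + 1 + 1) ^ 6 *
      ((fiveStepMoment (j + 1 + 1 + 1) : ℚ) /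
        (((j : ℚ) + 1 + 1 + 1) * (((j : ℚ) + 1 + 1) * (((j : ℚ) + 1) * (j ! : ℚ)))) ^ 2) *
        ((((j : ℚ) + 1 + 1) * (((j : ℚ) + 1) * (j ! : ℚ))) ^ 2) =
      ((j : ℚ) + 1 + 1 + 1) ^ 4 * (fiveStepMoment (j + 1 + 1 + 1) : ℚ) := by
    field_simp
  have e2 : (35 * ((j : ℚ) + 1 + 1) ^ 4 + 70 * ((j : ℚ) + 1 + 1) ^ 3 + 63 * ((j : ℚ) + 1 + 1) ^ 2 +
        28 * ((j : ℚ) + 1 + 1) + 5) *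
      ((fiveStepMoment (j + 1 + 1) : ℚ) / (((j : ℚ) + 1 + 1) * (((j : ℚ) + 1) * (j ! : ℚ))) ^ 2) *
        ((((j : ℚ) + 1 + 1) * (((j : ℚ) + 1) * (j ! : ℚ))) ^ 2) =
      (35 * ((j : ℚ) + 1 + 1) ^ 4 + 70 * ((j : ℚ) + 1 + 1) ^ 3 + 63 * ((j : ℚ) + 1 + 1) ^ 2 +
        28 * ((j : ℚ) + 1 + 1) + 5) * (fiveStepMoment (j + 1 + 1) : ℚ) := by
    field_simp
  have e3 : (259 * ((j : ℚ) + 1) ^ 2 + 518 * ((j : ℚ) + 1) + 285) *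
      ((fiveStepMoment (j + 1) : ℚ) / (((j : ℚ) + 1) * (j ! : ℚ)) ^ 2) *
        ((((j : ℚ) + 1 + 1) * (((j : ℚ) + 1) * (j ! : ℚ))) ^ 2) =
      ((j : ℚ) + 1 + 1) ^ 2 * (259 * ((j : ℚ) + 1) ^ 2 + 518 * ((j : ℚ) + 1) + 285) *
        (fiveStepMoment (j + 1) : ℚ) := by
    field_simp
  have e4 : 225 * ((fiveStepMoment j : ℚ) / (j ! : ℚ) ^ 2) *
      ((((j : ℚ) + 1 + 1) * (((j : ℚ) + 1) * (j ! : ℚ))) ^ 2) =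
      225 * (((j : ℚ) + 1) * ((j : ℚ) + 1 + 1)) ^ 2 * (fiveStepMoment j : ℚ) := by
    field_simp
  have key : ((j : ℚ) + 3) ^ 4 * (fiveStepMoment (j + 3) : ℚ) +
      ((j : ℚ) + 2) ^ 2 * (259 * ((j : ℚ) + 2) ^ 2 + 26) * (fiveStepMoment (j + 1) : ℚ) =
      (35 * ((j : ℚ) + 2) ^ 4 + 70 * ((j : ℚ) + 2) ^ 3 + 63 * ((j : ℚ) + 2) ^ 2 + 28 * ((j : ℚ) + 2) + 5) *
          (fiveStepMoment (j + 2) : ℚ) +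
        225 * (((j : ℚ) + 1) * ((j : ℚ) + 2)) ^ 2 * (fiveStepMoment j : ℚ) := by
    rw [show j + 3 = j + 1 + 1 + 1 from rfl, show j + 2 = j + 1 + 1 from rfl]
    linear_combination ((((j : ℚ) + 1 + 1) * (((j : ℚ) + 1) * (j ! : ℚ))) ^ 2) * h - e1 + e2 - e3 + e4
  exact_mod_cast key

end Literature.Combinatorics.Enumerative

end
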